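import Summits.BirchSwinnertonDyer.BirchSwinnertonDyer.Theorems.Rank2Observatory2DescClKillCurveCertE2Defs
import Summits.BirchSwinnertonDyer.BirchSwinnertonDyer.Theorems.Rank2Observatory2DescKillValid
import HarnessLib

/-!
# BirchSwinnertonDyer — rank ≥ 2 observatory: KERNEL-2DESC-CL v3.7, E2V — two-view (η-family) certificates with a kill list in VALIDITY form, part 1/3: checkers

HONEST FRAMING: per-curve certified theorems and census instruments; no claim on BSD in rank ≥ 2.

Part 1 of 3.  The v2.7 kill rows (`Rank2Observatory2DescClKillCurveCertE2*`, E2K) carry each kill as ONE residue-tree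
Boolean `killCheck p … fuel` at a prime `p ∈ killPrimes = [2, …, 23]`; 1 226 curves of that tranche have NO such kill
(`generics/e2v/E2V-SPEC.md`).  The E2V census (cert-1 gen 27, `census/e2v/`) finds kills for them in OTHER certificate
shapes (quartic-model residue trees `qkCert` / norm conics `conicCert` of `Rank2Observatory2DescKillQuartic` /
`…KillConic`, the linear depth-2 certificate `l2Check` of `Rank2Observatory2DescKillLin`, the Lemma-6/7 lift `qlCert`).
This layer re-types the kill hypothesis of the E2K rows as the shape-independent PROPOSITION `TwoDescKill.KillValidAt`
(`Rank2Observatory2DescKillValid`) — exactly what `Rank2Observatory2DescClKillCurveCertSVDefs` (v3.1, SKV) did for the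
split-2 rows:

* `ClKillE2.liteV` — the light clause WITHOUT `p ∈ killPrimes` (`z ≠ 0`, class non-trivial); the kill records, classes,
  representatives, `KillEntry`s and the sieve `admE2K` are the E2K ones, unchanged;
* `KillValidE2 F cc ks : Prop` — every listed kill is at a prime and VALID (`KillValidAt p a b c z t₁ t₂`), supplied per
  kill by `killValidAt_of_killCheck` (tree, any prime), `killValidAt_of_l2Check` (linear depth 2), `qkCert_sound` /
  `conicCert_sound` (quartic model) or any later form;
* `checkE2KV F cc r ks` — `checkE2K` with `liteV` for `lite`, clause for clause;
* `killListCheckV_of_liteE2V`, `killValid_entries_of_killValidE2`, `noTrivial_of_liteE2V` — the glue to the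
  validity-form list certificate `killListCheckV` / `admKillsV_sound`.

Text = `Rank2Observatory2DescClKillCurveCertE2Defs` by the substitution script `generics/e2v/tools/mk_e2v.py`.
New declarations only; sorry-free. [cite: Cassels1991LecturesEllipticCurves, §15] [cite: CremonaAlgorithms1997, §3.6]
-/
set_option linter.dupNamespace false

noncomputable section

open scoped Classical NumberField nonZeroDivisors

open Literature.NumberTheory.NumberFields Polynomial Module NumberField IsDedekindDomain Ideal

namespace Summit.BirchSwinnertonDyer.BirchSwinnertonDyer.Rank2Observatory.TwoDescCl

open TwoDescCubic ClFieldCert TwoDescKill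

/-! ## Validity-form clauses over the E2K kill records -/

section Checkers

variable (F : ClFieldCertE2) (cc : ClCurveCertE2)

/-- **Light kill clause, validity form**: `z ≠ 0` and the class is not the trivial class (NO prime list).
Computable. [folklore] -/
def ClKillE2.liteV (k : ClKillE2) : Bool :=
  decide (k.z F cc ≠ ((0 : ℤ), (0 : ℤ), (0 : ℤ))) && decide (k.cls cc ≠ ∅)

/-- **The kills of a two-view row, validity form**: every raw kill is at a prime `p` and the quadric pair of its class
has no integer zero primitive at `p` (`TwoDescKill.KillValidAt`, at the `α`-coordinates `(t₁, t₂)` of `X_t = m₁ · e`).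
A hypothesis of the soundness theorem, discharged kill by kill (`killValidE2_cons`, part 3) by ANY certificate form.
[cite: CremonaAlgorithms1997, §3.6] -/
def KillValidE2 (ks : List ClKillE2) : Prop :=
  ∀ k ∈ ks, k.p.Prime ∧ KillValidAt k.p F.fe.base.a F.fe.base.b F.fe.base.c (k.z F cc) cc.Xt.2.1 cc.Xt.2.2

/-- **The two-view per-curve `r`-checker with a kill list, validity form**: `checkE2K F cc r ks` with the light
clause `liteV` (no prime list) in place of `lite`, clause for clause; FEWER THAN `2^(r+1)` classes pass `admE2K`.  Computable; run by `decide +kernel`.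
[cite: Cassels1991LecturesEllipticCurves, §15] [cite: CremonaAlgorithms1997, §3.6] -/
def checkE2KV (r : ℕ) (ks : List ClKillE2) : Bool :=
  decide (deltaShort cc.A cc.B cc.C ≠ 0) &&
    noRootMod cc.pF cc.A cc.B cc.C &&
    decide (cubicAtCoords F.fe.base.a F.fe.base.b F.fe.base.c ((F.m₁ : ℤ) * cc.A) ((F.m₁ : ℤ) ^ 2 * cc.B)
      ((F.m₁ : ℤ) ^ 3 * cc.C) cc.Xt = (0, 0, 0)) &&
    decide (derivAtCoords F.fe.base.a F.fe.base.b F.fe.base.c ((F.m₁ : ℤ) * cc.A) ((F.m₁ : ℤ) ^ 2 * cc.B) cc.Xt =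
      MonicCubic.mulCoords F.fe.base.a F.fe.base.b F.fe.base.c (smulCoords (F.m₁ : ℤ) cc.XD)
        (prodPowCoords F.fe.base.a F.fe.base.b F.fe.base.c [])) &&
    twoViewCheck F.fe.base.a F.fe.base.b F.fe.base.c F.fe.u F.fe.d F.m₁ F.m₂ cc.Xt cc.Yt &&
    twoViewCheck F.fe.base.a F.fe.base.b F.fe.base.c F.fe.u F.fe.d F.m₁ F.m₂ cc.XD cc.YD &&
    decide (MonicCubic.disc cc.A cc.B cc.C < 0) &&
    decide (normFormZ F.fe.base.a F.fe.base.b F.fe.base.c cc.XD.1 cc.XD.2.1 cc.XD.2.2 ≠ 0) &&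
    decide ((normFormZ F.fe.base.a F.fe.base.b F.fe.base.c cc.XD.1 cc.XD.2.1 cc.XD.2.2).natAbs =
      (cc.dn.map fun pe => pe.1 ^ pe.2).prod) &&
    (cc.dn.all fun pe => primeDispatch F cc cc.XD cc.YD cc.dinvA cc.dinvE pe.1) &&
    (cc.codes.all fun bc => codeClause F cc bc) &&
    invCert F.fe.base.a F.fe.base.b F.fe.base.c F.fe.base.w₁ cc.XD cc.dW1 &&
    invCert F.fe.base.a F.fe.base.b F.fe.base.c F.fe.base.w₂ cc.XD cc.dW2 &&
    (cc.Q.all fun q => decide (0 < q)) &&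
    decide (cc.head.length = 4) &&
    ((fam2 cc).all fun f => famCheckE2 F cc f) &&
    decide (∀ T : Finset (Fin (fam2 cc).length), T ≠ ∅ →
      ∃ k : Fin (F.fe.base.chars.length + 3), Odd (T.filter fun j => bit2 F cc k j = true).card) &&
    (ks.all fun k => k.liteV F cc) &&
    decide (((Finset.univ ×ˢ Finset.univ).filter
      (fun p : Finset (Fin 0) × Finset (Fin (fam2 cc).length) => admE2K F cc ks p.1 p.2 = true)).card <
        2 ^ (r + 1))

variable {F cc}

/-- The light clauses and the primality of the kill primes give the validity-form list certificate `killListCheckV`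
(the product clause holds by `rfl`). [folklore] -/
theorem killListCheckV_of_liteE2V {ks : List ClKillE2} (hl : ∀ k ∈ ks, k.liteV F cc = true) (hk : KillValidE2 F cc ks) :
    killListCheckV F.fe.base.a F.fe.base.b F.fe.base.c unitCoordsE2 (famCoordsE2 cc) (killEntriesE2 F cc ks) = true := by
  rw [killListCheckV, List.all_eq_true]
  intro e he
  obtain ⟨k, hkm, rfl⟩ := List.mem_map.mp he
  have h := hl k hkm
  simp only [ClKillE2.liteV, Bool.and_eq_true, decide_eq_true_eq] at h
  obtain ⟨hz, -⟩ := h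
  simp only [ClKillE2.toEntry, Bool.and_eq_true, decide_eq_true_eq]
  exact ⟨⟨(hk k hkm).1, rfl⟩, hz⟩

/-- The validity of every `KillEntry` of the row. [folklore] -/
theorem killValid_entries_of_killValidE2 {ks : List ClKillE2} (hk : KillValidE2 F cc ks) :
    ∀ e ∈ killEntriesE2 F cc ks,
      KillValidAt e.p F.fe.base.a F.fe.base.b F.fe.base.c e.z cc.Xt.2.1 cc.Xt.2.2 := by
  intro e he
  obtain ⟨k, hkm, rfl⟩ := List.mem_map.mp he
  exact (hk k hkm).2

/-- No listed class is the trivial class. [folklore] -/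
theorem noTrivial_of_liteE2V {ks : List ClKillE2} (hl : ∀ k ∈ ks, k.liteV F cc = true) :
    ((killEntriesE2 F cc ks).all fun e => !(decide (e.T = ∅) && decide (e.U = ∅))) = true := by
  rw [List.all_eq_true]
  intro e he
  obtain ⟨k, hkm, rfl⟩ := List.mem_map.mp he
  have h := hl k hkm
  simp only [ClKillE2.liteV, Bool.and_eq_true, decide_eq_true_eq] at h
  simp [ClKillE2.toEntry, h.2]

end Checkers

end Summit.BirchSwinnertonDyer.BirchSwinnertonDyer.Rank2Observatory.TwoDescCl

end
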